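import Literature.RepresentationTheory.ModularTensorCategories.ModularDatum

/-!
# Pointed (abelian) premodular data from abelian 3-cocycles; the `ℤ_N` bicharacter data

Topic `Literature/RepresentationTheory/ModularTensorCategories` (definition item `defn-ModularDatum`:
the "pointed (abelian) instances `ℤ_N^{(p)}`" asked for by route `QuantumFields/ModularSelfDualFold`,
and the non-vacuity witnesses of `PreModularDatum`).

For a finite abelian group `A`, a normalised `U(1)`-valued 3-cocycle `ω` and a braiding function
`c` satisfying the two hexagon identities (an **abelian 3-cocycle** in the sense of
Eilenberg–Mac Lane) present the pointed braided fusion category `Vec_A^{(ω,c)}`: labels `A`,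
fusion `a ⊗ b = a + b`, `d ≡ 1`, `[F^{abc}_{a+b+c}]_{a+b,b+c} = ω(a,b,c)`, `R^{ab}_{a+b} = c(a,b)`,
`θ_a = c(a,a)`, `S_{ab} = |A|^{-1/2} θ_{a-b}/(θ_a θ_b)` (Kitaev's formula with `N_{a,-b}^x = δ_{x,a-b}`).

* `AbelianCocycle A` — the data `(ω, c)` and its identities (plus, as two further fields, the
  pointed forms `c(-x,-x) = c(x,x)`, `c(x,y)c(y,x) = q(x+y)/(q(x)q(y))` of `θ_ā = θ_a` and of the
  ribbon identity).
* `AbelianCocycle.toPreModularDatum` — EVERY axiom of `PreModularDatum` proved: pentagon = the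
  cocycle identity, hexagons = the abelian-cocycle identities, unitarity from `|ω| = |c| = 1`.
* `AbelianCocycle.ofBicharacter` — `ω = 1`, `c = χ` a unitary bicharacter.
* `zmodPointed N p : PreModularDatum (ZMod N)` — `χ(a,b) = e(p·a·b/N)` via `ZMod.stdAddChar`.

Deliberately NOT here: modularity of `zmodPointed N p` (holds iff `gcd(2p, N) = 1`; a character-sum
computation), the semion and its modularity (sibling file `Semion.lean`, which needs the
nontrivial 3-cocycle on `ℤ₂`), `SU(2)_k` for `k ≥ 2`.
-/

noncomputable section

open scoped ComplexConjugate Matrix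

namespace Literature.RepresentationTheory.ModularTensorCategories

universe u

variable {A : Type u} [AddCommGroup A]

/-- An **abelian 3-cocycle** `(ω, c)` on a finite abelian group `A` with values in `U(1) ⊂ ℂ`:
`ω` a normalised 3-cocycle (`cocycle`), `c` normalised and satisfying the two hexagon identities
relative to `ω` — exactly the F- and R-symbols of a pointed braided fusion category `Vec_A^{(ω,c)}`
— together with, as two further FIELDS, the pointed specialisations of the ribbon-category
identities `θ_ā = θ_a` and `R^{ab}_c R^{ba}_c = θ_c/(θ_a θ_b)` for `θ_a := c(a,a)`, namely
`c(-x,-x) = c(x,x)` and `c(x,y) c(y,x) = q(x+y)/(q(x) q(y))` (`q(x) = c(x,x)`); every instance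
proves all of them. [cite: Kitaev2006, App. E.1.2 (pentagon), E.3 (hexagons; |θ_a| = 1, θ_ā = θ_a, R^{ba}R^{ab} = θ_c/(θ_aθ_b)), specialised to d_a = 1]
[cite: BondersonShtengelSlingerland2008, §3.6.1 (the ℤ_N^{(w)} models: F, R^{ab}_{[a+b]}, θ_a as such functions)] -/
structure AbelianCocycle (A : Type u) [AddCommGroup A] where
  /-- The associator 3-cocycle `ω(x,y,z) = [F^{xyz}_{x+y+z}]_{x+y, y+z}`. -/
  ω : A → A → A → ℂ
  /-- The braiding `c(x,y) = R^{xy}_{x+y}`. -/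
  c : A → A → ℂ
  /-- `|ω| = 1`. -/
  norm_ω : ∀ x y z, ‖ω x y z‖ = 1
  /-- `|c| = 1`. -/
  norm_c : ∀ x y, ‖c x y‖ = 1
  /-- `ω` is normalised. -/
  ω_unit : ∀ x y z, (x = 0 ∨ y = 0 ∨ z = 0) → ω x y z = 1
  /-- `c(0,x) = 1`. -/
  c_unit_left : ∀ x, c 0 x = 1
  /-- `c(x,0) = 1`. -/
  c_unit_right : ∀ x, c x 0 = 1
  /-- The 3-cocycle identity (= pentagon). -/
  cocycle : ∀ x y z w, ω (x + y) z w * ω x y (z + w) = ω x y z * ω x (y + z) w * ω y z w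
  /-- First hexagon identity. -/
  hexagon : ∀ x y z, c z x * ω x z y * c z y = ω z x y * c z (x + y) * ω x y z
  /-- Second hexagon identity. -/
  hexagon_inv : ∀ x y z, (c x z)⁻¹ * ω x z y * (c y z)⁻¹ = ω z x y * (c (x + y) z)⁻¹ * ω x y z
  /-- `q(-x) = q(x)` for `q(x) = c(x,x)` (the twist is conjugation invariant). -/
  c_neg : ∀ x, c (-x) (-x) = c x x
  /-- Ribbon identity `c(x,y) c(y,x) = q(x+y) / (q(x) q(y))`. -/
  c_mul_c : ∀ x y, c x y * c y x = c (x + y) (x + y) / (c x x * c y y)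

namespace AbelianCocycle

variable (κ : AbelianCocycle A)

/-- `ω ≠ 0`. [folklore] -/
theorem ω_ne_zero (x y z : A) : κ.ω x y z ≠ 0 := fun h => by simpa [h] using κ.norm_ω x y z

/-- `c ≠ 0`. [folklore] -/
theorem c_ne_zero (x y : A) : κ.c x y ≠ 0 := fun h => by simpa [h] using κ.norm_c x y

variable [DecidableEq A]

/-- The F-symbols of `Vec_A^{(ω,c)}` extended by zero: `[F^{abc}_d]_{ef} = ω(a,b,c)` if `e = a+b`,
`f = b+c`, `d = e+c`, else `0`. [folklore] -/
def fSymbol (a b c d e f : A) : ℂ :=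
  if e = a + b then (if f = b + c then (if d = a + b + c then κ.ω a b c else 0) else 0) else 0

/-- The R-symbols of `Vec_A^{(ω,c)}` extended by zero: `R^{ab}_c = c(a,b)` if `c = a+b`, else `0`.
[folklore] -/
def rSymbol (a b c : A) : ℂ := if c = a + b then κ.c a b else 0

/-- Unfolding lemma for `fSymbol`. [folklore] -/
theorem fSymbol_def (a b c d e f : A) : κ.fSymbol a b c d e f =
    if e = a + b then (if f = b + c then (if d = a + b + c then κ.ω a b c else 0) else 0) else 0 :=
  rfl

/-- Unfolding lemma for `rSymbol`. [folklore] -/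
theorem rSymbol_def (a b c : A) : κ.rSymbol a b c = if c = a + b then κ.c a b else 0 := rfl

/-- Inverse of `rSymbol`, extended by zero. [folklore] -/
theorem rSymbol_inv (a b c : A) :
    (κ.rSymbol a b c)⁻¹ = if c = a + b then (κ.c a b)⁻¹ else 0 := by
  rw [rSymbol_def]; split_ifs <;> simp

variable [Fintype A]

/-- The S-matrix `S_{ab} = |A|^{-1/2} q(a-b)/(q(a) q(b))`, `q(x) = c(x,x)`. [folklore] -/
def sMatrix : Matrix A A ℂ :=
  Matrix.of fun a b => κ.c (a - b) (a - b) / (κ.c a a * κ.c b b) / (Real.sqrt (Fintype.card A) : ℂ)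

/-- The pointed premodular datum `Vec_A^{(ω,c)}`: labels `A`, `a ⊗ b = a + b`, `dual a = -a`,
`d ≡ 1`, `F = ω`, `R = c`, `θ_a = c(a,a)`, `S_{ab} = |A|^{-1/2} q(a-b)/(q(a) q(b))`; every axiom
of `PreModularDatum` is verified (pentagon = cocycle identity, hexagons = abelian-cocycle
identities). [cite: Kitaev2006, App. E (skeletal data of a unitary braided fusion category), invertible objects]
[cite: RowellStongWang2007, §5.3.3 (the ℤ₃ example: F = 1, R, θ, S of this form)] -/
def toPreModularDatum : PreModularDatum A where
  unit := 0
  dual := fun a => -a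
  N := fun a b c => if c = a + b then 1 else 0
  dual_dual := fun a => neg_neg a
  N_unit_left := fun b c => by simp [eq_comm]
  N_comm := fun a b c => by simp [add_comm]
  N_assoc := fun a b c d => by
    simp only [ite_mul, one_mul, zero_mul, Finset.sum_ite_eq', Finset.mem_univ, if_true]
    simp [add_assoc]
  N_dual := fun a b => by
    by_cases h : b = -a
    · subst h; simp
    · rw [if_neg h, if_neg]; intro h0; exact h (eq_neg_of_add_eq_zero_right h0.symm)
  N_conj := fun a b c => by simp only [← neg_add, neg_inj]
  N_le_one := fun a b c => by split_ifs <;> norm_num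
  d := fun _ => 1
  d_pos := fun _ => one_pos
  d_dual := fun _ => rfl
  d_fusion := fun a b => by simp
  F := κ.fSymbol
  F_support := by
    intro a b c d e f h
    rw [fSymbol_def]
    split_ifs with h1 h2 h3
    · subst h1; subst h2; subst h3; simp [add_assoc] at h
    all_goals rfl
  F_unit := by
    intro a b c d e f habc h
    simp only [ne_eq, mul_eq_zero, ite_eq_right_iff, one_ne_zero, imp_false, not_or, not_not] at h
    obtain ⟨⟨⟨rfl, rfl⟩, rfl⟩, -⟩ := h
    rw [fSymbol_def, if_pos rfl, if_pos rfl, if_pos rfl]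
    exact κ.ω_unit a b c habc
  F_unitary := by
    intro a b c d e e'
    rw [Finset.sum_eq_single (b + c)]
    · by_cases he : e = a + b
      · subst he
        by_cases hd : d = a + b + c
        · subst hd
          by_cases he' : e' = a + b
          · subst he'
            simp [fSymbol_def, Complex.mul_conj, Complex.normSq_eq_norm_sq, κ.norm_ω]
          · simp [fSymbol_def, he', Ne.symm he']
        · simp [fSymbol_def, hd]
      · simp [fSymbol_def, he]
    · intro f _ hf
      simp [fSymbol_def, hf]
    · exact fun h => (h (Finset.mem_univ _)).elim
  F_unitary' := by
    intro a b c d f f'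
    rw [Finset.sum_eq_single (a + b)]
    · by_cases hf : f = b + c
      · subst hf
        by_cases hd : d = a + b + c
        · subst hd
          by_cases hf' : f' = b + c
          · subst hf'
            simp [fSymbol_def, Complex.conj_mul', κ.norm_ω, add_assoc]
          · simp [fSymbol_def, hf', Ne.symm hf']
        · have hd' : ¬ d = a + (b + c) := by rwa [← add_assoc]
          simp [fSymbol_def, hd, hd']
      · simp [fSymbol_def, hf]
    · intro e _ he
      simp [fSymbol_def, he]
    · exact fun h => (h (Finset.mem_univ _)).elim
  norm_F_dual := fun a => by simp [fSymbol_def, κ.norm_ω]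
  pentagon := by
    intro a b c d e f g k l
    rw [Finset.sum_eq_single (b + c)]
    · by_cases hf : f = a + b
      · subst hf
        by_cases hl : l = c + d
        · subst hl
          by_cases hg : g = a + b + c
          · subst hg
            by_cases hk : k = b + (c + d)
            · subst hk
              by_cases he : e = a + (b + (c + d))
              · subst he
                simp only [fSymbol_def, add_assoc, if_true]
                linear_combination κ.cocycle a b c d
              · simp only [fSymbol_def, add_assoc] at he ⊢
                simp [he]
            · simp only [fSymbol_def, add_assoc] at hk ⊢
              simp [hk]
          · simp only [fSymbol_def, add_assoc] at hg ⊢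
            simp [hg]
        · simp [fSymbol_def, hl]
      · simp [fSymbol_def, hf]
    · intro h _ hh
      simp [fSymbol_def, hh]
    · exact fun h => (h (Finset.mem_univ _)).elim
  R := κ.rSymbol
  R_support := fun a b c h => by
    simp only [ite_eq_right_iff, one_ne_zero, imp_false] at h
    rw [rSymbol_def, if_neg h]
  norm_R := fun a b c h => by
    simp only [ne_eq, ite_eq_right_iff, one_ne_zero, imp_false, not_not] at h
    rw [rSymbol_def, if_pos h, κ.norm_c]
  R_unit_left := fun a => by simp [rSymbol_def, κ.c_unit_left]
  R_unit_right := fun a => by simp [rSymbol_def, κ.c_unit_right]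
  hexagon := by
    intro a b c d e g
    rw [Finset.sum_eq_single (a + b)]
    · by_cases he : e = c + a
      · subst he
        by_cases hg : g = c + b
        · subst hg
          by_cases hd : d = c + (a + b)
          · subst hd
            have h := κ.hexagon a b c
            simp only [fSymbol_def, rSymbol_def, add_comm, add_left_comm, if_true] at h ⊢
            linear_combination h
          · simp only [fSymbol_def, rSymbol_def, add_comm, add_left_comm] at hd ⊢
            simp [hd]
        · simp only [fSymbol_def, rSymbol_def, add_comm, add_left_comm] at hg ⊢
          simp [hg]
      · simp only [fSymbol_def, rSymbol_def, add_comm, add_left_comm] at he ⊢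
        simp [he]
    · intro f _ hf
      simp [fSymbol_def, hf]
    · exact fun h => (h (Finset.mem_univ _)).elim
  hexagon_inv := by
    intro a b c d e g
    rw [Finset.sum_eq_single (a + b)]
    · by_cases he : e = a + c
      · subst he
        by_cases hg : g = b + c
        · subst hg
          by_cases hd : d = c + (a + b)
          · subst hd
            have h := κ.hexagon_inv a b c
            simp only [fSymbol_def, rSymbol_inv, add_comm, add_left_comm, if_true] at h ⊢
            linear_combination h
          · simp only [fSymbol_def, rSymbol_inv, add_comm, add_left_comm] at hd ⊢
            simp [hd]
        · simp only [fSymbol_def, rSymbol_inv, add_comm, add_left_comm] at hg ⊢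
          simp [hg]
      · simp only [fSymbol_def, rSymbol_inv, add_comm, add_left_comm] at he ⊢
        simp [he]
    · intro f _ hf
      simp [fSymbol_def, hf]
    · exact fun h => (h (Finset.mem_univ _)).elim
  twist := fun a => κ.c a a
  twist_eq := fun a => by
    rw [Finset.sum_eq_single (a + a)]
    · simp [rSymbol_def]
    · intro c _ hc; simp [rSymbol_def, hc]
    · exact fun h => (h (Finset.mem_univ _)).elim
  norm_twist := fun a => κ.norm_c a a
  twist_dual := fun a => κ.c_neg a
  ribbon := fun a b c h => by
    simp only [ne_eq, ite_eq_right_iff, one_ne_zero, imp_false, not_not] at h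
    subst h
    rw [rSymbol_def, rSymbol_def, if_pos rfl, if_pos (add_comm a b), κ.c_mul_c]
  S := κ.sMatrix
  S_eq := fun a b => by
    rw [sMatrix, Matrix.of_apply, Finset.sum_eq_single (a - b)]
    · simp [sub_eq_add_neg]
    · intro c _ hc
      rw [if_neg (by rwa [← sub_eq_add_neg]), Nat.cast_zero, zero_mul, zero_mul]
    · exact fun h => (h (Finset.mem_univ _)).elim

/-- Unfolding lemma. [folklore] -/
@[simp] theorem toPreModularDatum_unit : κ.toPreModularDatum.unit = 0 := rfl
/-- Unfolding lemma. [folklore] -/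
@[simp] theorem toPreModularDatum_dual (a : A) : κ.toPreModularDatum.dual a = -a := rfl
/-- Unfolding lemma. [folklore] -/
@[simp] theorem toPreModularDatum_N (a b c : A) :
    κ.toPreModularDatum.N a b c = if c = a + b then 1 else 0 := rfl
/-- Unfolding lemma. [folklore] -/
@[simp] theorem toPreModularDatum_d (a : A) : κ.toPreModularDatum.d a = 1 := rfl
/-- Unfolding lemma. [folklore] -/
@[simp] theorem toPreModularDatum_F : κ.toPreModularDatum.F = κ.fSymbol := rfl
/-- Unfolding lemma. [folklore] -/
@[simp] theorem toPreModularDatum_R : κ.toPreModularDatum.R = κ.rSymbol := rfl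
/-- Unfolding lemma. [folklore] -/
@[simp] theorem toPreModularDatum_twist (a : A) : κ.toPreModularDatum.twist a = κ.c a a := rfl
/-- Unfolding lemma. [folklore] -/
@[simp] theorem toPreModularDatum_S : κ.toPreModularDatum.S = κ.sMatrix := rfl

end AbelianCocycle

end Literature.RepresentationTheory.ModularTensorCategories

namespace Literature.RepresentationTheory.ModularTensorCategories

namespace AbelianCocycle

universe u

variable {A : Type u} [AddCommGroup A]

/-- The abelian cocycle of a **unitary bicharacter** `χ` (trivial associator `ω = 1`, braiding
`c = χ`): the data of the pointed braided categories with symmetric-bilinear-type braiding, e.g.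
`χ(a,b) = exp(2πi p ab/N)` on `ℤ_N`. [folklore] -/
def ofBicharacter (χ : A → A → ℂ) (hl : ∀ x y z, χ (x + y) z = χ x z * χ y z)
    (hr : ∀ x y z, χ x (y + z) = χ x y * χ x z) (hn : ∀ x y, ‖χ x y‖ = 1) : AbelianCocycle A :=
  have hne : ∀ x y, χ x y ≠ 0 := fun x y h => by simpa [h] using hn x y
  have h0l : ∀ y, χ 0 y = 1 := fun y => by
    have h := hl 0 0 y
    rw [add_zero] at h
    exact (mul_eq_left₀ (hne 0 y)).mp h.symm
  have h0r : ∀ x, χ x 0 = 1 := fun x => by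
    have h := hr x 0 0
    rw [add_zero] at h
    exact (mul_eq_left₀ (hne x 0)).mp h.symm
  have hnl : ∀ x y, χ (-x) y = (χ x y)⁻¹ := fun x y => by
    have h := hl x (-x) y
    rw [add_neg_cancel, h0l] at h
    exact eq_inv_of_mul_eq_one_right h.symm
  have hnr : ∀ x y, χ x (-y) = (χ x y)⁻¹ := fun x y => by
    have h := hr x y (-y)
    rw [add_neg_cancel, h0r] at h
    exact eq_inv_of_mul_eq_one_right h.symm
  { ω := fun _ _ _ => 1
    c := χ
    norm_ω := fun _ _ _ => by simp
    norm_c := hn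
    ω_unit := fun _ _ _ _ => rfl
    c_unit_left := h0l
    c_unit_right := h0r
    cocycle := fun _ _ _ _ => by simp
    hexagon := fun x y z => by rw [hr]; ring
    hexagon_inv := fun x y z => by rw [hl, mul_inv]; ring
    c_neg := fun x => by rw [hnl, hnr, inv_inv]
    c_mul_c := fun x y => by
      rw [hl, hr, hr]
      field_simp [hne x x, hne y y] }

end AbelianCocycle

/-- The pointed premodular datum `ℤ_N^{(p)}` (`p ∈ ℤ`; Bonderson–Shtengel–Slingerland's `ℤ_N^{(w)}`
with integer `w = p`): labels `ZMod N`, fusion = addition, `F ≡ 1` on admissible labellings,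
braiding `R^{ab}_{a+b} = e(p·a·b/N)` (`e(t) = exp(2πi t)`, realised by the standard additive
character of `ZMod N`), `θ_a = e(p a²/N)`, `S_{ab} = N^{-1/2} e(-2p·ab/N)` (Kitaev's sign
convention for `S`; BSS print the complex conjugate). NOT the half-integer `w` theories (`N` even;
e.g. the semion `ℤ₂^{(1/2)}`, Gannon's (6.1.8)), which need the nontrivial 3-cocycle — see
`Semion.lean`. Modularity (iff `gcd(2p, N) = 1`) is not proved here.
[cite: BondersonShtengelSlingerland2008, §3.6.1 (ℤ_N^{(w)}, w = n: F = 1, R^{ab}_{[a+b]} = e^{2πi w ab/N}, θ_a = e^{2πi w a²/N}, d_a = 1, 𝒟 = √N)]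
[cite: RowellStongWang2007, §5.3.3 (ℤ₃ = the case N = 3, p = 1: F = 1, R, θ, S)] -/
def zmodPointed (N : ℕ) [NeZero N] (p : ℤ) : PreModularDatum (ZMod N) :=
  (AbelianCocycle.ofBicharacter (fun a b => ZMod.stdAddChar ((p : ZMod N) * a * b))
    (fun x y z => by simp only [mul_add, add_mul, AddChar.map_add_eq_mul])
    (fun x y z => by simp only [mul_add, AddChar.map_add_eq_mul])
    (fun x y => AddChar.norm_apply _ _)).toPreModularDatum

end Literature.RepresentationTheory.ModularTensorCategories
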